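import Literature.NumberTheory.Weil1964.ArchMetaplecticStrongTopology
import Literature.NumberTheory.Weil1964.ArchMetaplecticDoubleCoverHolds
import Literature.RepresentationTheory.Paul1998.DetCoverCocycleRankOne
import Literature.RepresentationTheory.Paul1998.DetCoverLiftingCriterion
import HarnessLib

/-!
# Paul 1998 (1.2.1)–(1.2.2) for the metaplectic double cover `Mp₂(𝕎)` at real rank one: the record
# `DetCoverLifting` of `Mp₂.coverDatum` — PROVED from a splitting of the `S¹`-extension and R1/R2 (kernel; 0 named facts)

Topic `RepresentationTheory/Paul1998`; namespace `Literature.RepresentationTheory.Paul1998.MetaplecticSplitting`.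
Row B08-2 step (3)(vi) of the pub-hodgecm2 literature fan-out (`HOME/lit/audit-B08-2.md`), second half; the JUNCTION of
three tree files:
* B08-1 `Literature.RepresentationTheory.Paul1998.DetCoverLiftingCriterion` — the record shape
  `DualPairCoverDatum.DetCoverLifting` ([Paul1998, §1.2 (1.2.1)–(1.2.2)]: a CONTINUOUS homomorphism from the product of
  the `det^{(r−s)/2}`-cover of `U(p,q)` and the `det^{(p−q)/2}`-cover of `U(r,s)` into the metaplectic cover, over `ι_J`,
  an isomorphism onto `Ũ(p,q)`, `Ũ(r,s)` on the factors) and its sufficient datum `detCoverLifting_of_cocycleSections`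
  (two `CocycleSection`s with `τ`, `σ` continuous AT `1`, commutation of the two inverse images, `[ContinuousMul Mp]`);
* B08-2 (a) `Literature.NumberTheory.Weil1964.ArchMetaplecticSubgroup` — the metaplectic two-fold cover
  `Mp₂(𝕎) ≤ Mp^𝓢(𝕎)` and the datum `Mp₂.coverDatum P Q R S h1 h2` of the pair `(U(P,Q), U(R,S))` over
  `pr : Mp₂(𝕎) ↠ Sp(𝕎)` (under the cited records R1 `Folland1989_Thm_4_37_ab`, R2 `Folland1989_Thm_4_37_c`), with
  `Literature.NumberTheory.Weil1964.ArchMetaplecticStrongTopology` — the strong operator topology on `Mp^𝓢(𝕎)`, in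
  which `Mp₂(𝕎)` is a topological group whose two sheets are separated;
* B08-2 (b) `Literature.RepresentationTheory.Paul1998.DetCoverCocycleRankOne` — at real rank `≤ 1`, from the record
  `FockVacuumCharacter` (a splitting `ω` of the `S¹`-extension over `ι𝕎`, [KonnoKonno2007, Lemma 5.2]) + R1 + R2:
  `Mp^𝓢`-valued METAPLECTIC sections `τ` over `ι_V`, `ι_W` whose cocycle is the coboundary of a square root `σ` of
  `det^{|R|−|S|}`, resp. `det^{|P|−|Q|}` (`exists_cocycleSectionV/W(_of_isEmpty)`), and exact commutation of the two
  inverse images (`commute_of_fockVacuumCharacter`).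

What this file adds (all PROVED; hypotheses in §2–§5 exactly those of `DetCoverCocycleRankOne`: R1, R2 and the
EXISTING record `FockVacuumCharacter e`; §6 discharges R1/R2 by the tree's B07-3 theorems):
* §1 `SqrtDatum.continuousAt_τ` — the metaplectic section `τ(g) = s(g)·ω(g)` of a square-root datum is continuous (in
  the strong operator topology) wherever `s` is: `g ↦ τ(g) f = s(g) · ω(g) f ∈ L²` by (w1) of `IsArchWeilDatum`.
* §2 `continuousAt_sqrtDatumOfDet_s` — the square root `s = (det^{−m})^{1/2}` (principal branch) is continuous at `1`
  (`det 1 = 1` lies in the slit plane); `exists_continuous_cocycleSection_of_obstruction_eq` — B08-2 (b)'s engine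
  re-run with TWO MORE CONCLUSIONS: `ContinuousAt τ 1` and `ContinuousAt σ 1`.
* §3 the four member theorems `exists_continuous_cocycleSectionV/W(_of_isEmpty)` (as in `DetCoverCocycleRankOne` §10,
  plus continuity at `1`).
* §4 THE JUNCTION `cocycleSectionV`, `cocycleSectionW`: metaplectic-valued cocycle data, co-restricted into `Mp₂(𝕎)`
  (`Mp₂.mem_of_isMetaplectic`), ARE B08-1 `CocycleSection`s of `Mp₂.coverDatum P Q R S h1 h2` (exponent `|R| − |S|`)
  and of its `swap` (exponent `|P| − |Q|`) — the fields `τ, σ, pr_τ, σ_sq, τ_mul` match literally, `ε = −1`;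
  `commute_coverV_coverW` — B08-1's hypothesis `hc` for `Mp₂.coverDatum`, from the splitting.
* §5 **THE RECORD, PROVED at real rank `≤ 1` on both sides**: `detCoverLifting_of_fockVacuumCharacter`
  (`|Q| = |S| = 1`), `…_of_isEmpty_right` (`|Q| = 1`, `S = ∅`), `…_of_isEmpty_left`, `…_of_isEmpty` —
  `(Mp₂.coverDatum P Q R S h1 h2).DetCoverLifting` from `(junction P Q R S).FockVacuumCharacter e`, R1, R2; and
  `detCoverLifting_linearised` — for `U(P,1) × U(R,∅)`, `R ≠ ∅` (the E-term's archimedean pairs `U(2,1) × U(1)`,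
  `U(2,1) × U(2)`), from R1 and R2 ALONE (the splitting is the tree's `isArchWeilDatum_linWeil_neg_card`).
  Print: «there are two-fold covers `Ũ(p, q)` and `Ũ(r, s)` … and a lifting `ι̃ : Ũ(p, q) × Ũ(r, s) → S̃p` (1.2.1) of the
  map `ι_J` … `Ũ(p, q)` is isomorphic to the `det^{(r−s)/2}`-cover of `U(p, q)` … Similarly, `Ũ(r, s)` is isomorphic
  to the `det^{(p−q)/2}`-cover of `U(r, s)`» [Paul1998, §1.2 p. 389 L11–23, held `paper:doi-10-1006-jfan-1998-3330`
  p0006], here with `S̃p := Mp₂(𝕎)` in the strong operator topology and `ι̃` CONTINUOUS.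
* §6 HYPOTHESIS-FREE: R1 and R2 are THEOREMS of the tree (row B07-3, `ArchMetaplecticDoubleCoverHolds`:
  `folland1989_Thm_4_37_ab_holds`, `folland1989_Thm_4_37_c_holds`), so at the linearised slots the record holds with
  NO hypothesis at all (`detCoverLifting_linearised_holds`, `exists_isDetCoverLifting_linearised_holds`), and in general
  from the splitting `FockVacuumCharacter e` alone (`detCoverLifting_of_fockVacuumCharacter_holds`).

NOT HERE (unchanged from `DetCoverCocycleRankOne`): `min(|P|,|Q|) ≥ 2` or `min(|R|,|S|) ≥ 2` (needs `KAK` beyond real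
rank one; the record stays the citation there); continuity of `pr : Mp₂(𝕎) → Sp(𝕎)` (no topology on `Sp(𝕎)` in the
tree).  NO new `def … : Prop`, no `sorry`; net debt 0.

## References

* [Paul1998] A. Paul, *Howe correspondence for real unitary groups*, J. Funct. Anal. 159 (1998) 384–431, §1.2
  (1.2.1)–(1.2.2) p. 389 L11–29.
* [Folland1989] G. B. Folland, *Harmonic Analysis in Phase Space*, Princeton UP 1989, §4.2 p. 156, Thm. (4.37).
* [Adams2007] J. Adams, *The theta correspondence over ℝ*, World Scientific 2007, §3, Rem. 5.1, §6 II.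
* [KonnoKonno2007] K. Konno, T. Konno, Kyushu J. Math. 61 (2007), Lemma 5.2.
-/

set_option autoImplicit false

noncomputable section

open MeasureTheory Complex SchwartzMap Filter
open scoped InnerProductSpace ComplexConjugate Topology

namespace Literature.RepresentationTheory.Paul1998

namespace MetaplecticSplitting

open Literature.Analysis.SegalBargmann Literature.RepresentationTheory.HeisenbergGroup
open Literature.NumberTheory.Weil1964 Literature.NumberTheory.Weil1964.MpS

variable {σ : Type*} [Fintype σ] [DecidableEq σ]
variable {G : Type*} [Group G] [TopologicalSpace G]

local notation "L2R" σ => Lp ℂ 2 (volume : Measure (σ → ℝ))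
local notation "SR" σ => SchwartzMap (σ → ℝ) ℂ
local notation "SpR" σ => symplecticGroup (polar (dotPairing σ))

/-! ## 1. Continuity of the metaplectic section of a square-root datum -/

variable {ι : G →* SpR σ} {ω : Representation ℂ G (SR σ)}

/-- **The metaplectic section `τ` of a square-root datum is continuous wherever `s` is** (strong operator topology
on `Mp^𝓢(W)`): `τ(g) f = s(g) · ω(g) f`, and `g ↦ ω(g) f` is continuous into `𝓢(ℝ^σ)` by (w1), hence into `L²`.
[cite: Paul1998, §1.2 (1.2.1) p. 389 L11–23; Folland1989, §4.2 p. 156 L24] -/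
theorem SqrtDatum.continuousAt_τ (D : SqrtDatum ι ω) (hW : IsArchWeilDatum ι ω)
    (hR1 : Folland1989_Thm_4_37_ab σ) {g₀ : G} (hs : ContinuousAt D.s g₀) :
    ContinuousAt (D.τ hW hR1) g₀ := by
  rw [MpS.continuousAt_iff]
  intro f
  have h : (fun g => toL2 ((D.τ hW hR1 g).1.2 f)) = fun g => D.s g • toL2 (ω g f) := by
    funext g
    rw [D.τ_apply hW hR1 g f, map_smul]
  rw [h]
  exact hs.smul (toL2.continuous.comp (hW.continuous_apply f)).continuousAt

/-! ## 2. B08-2 (b)'s engine with continuity at `1` -/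

section Member

open Literature.NumberTheory.Automorphic Literature.NumberTheory.Automorphic.UnitaryGroup
open Literature.RepresentationTheory.KonnoKonno2007 Literature.RepresentationTheory.KonnoKonno2007.RealDualPair

variable {α β : Type*} [Fintype α] [DecidableEq α] [Fintype β] [DecidableEq β]
variable {P Q R S : Type*} [Fintype P] [DecidableEq P] [Fintype Q] [DecidableEq Q] [Fintype R] [DecidableEq R]
  [Fintype S] [DecidableEq S]

/-- Unfolding: `detHom g = det g` in `ℂ`. [folklore] -/
private theorem val_detHom_eq (g : UForm α β) :
    (UForm.detHom α β g : ℂ) = ((g : GL (α ⊕ β) ℂ) : Matrix (α ⊕ β) (α ⊕ β) ℂ).det := rfl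

/-- Unfolding: `detHom g = GL.det g`. [folklore] -/
private theorem detHom_eq (g : UForm α β) :
    UForm.detHom α β g = Matrix.GeneralLinearGroup.det (g : GL (α ⊕ β) ℂ) := rfl

/-- `det g ≠ 0` on `U(α, β)`. [folklore] -/
private theorem det_ne_zero' (g : UForm α β) : ((g : GL (α ⊕ β) ℂ) : Matrix (α ⊕ β) (α ⊕ β) ℂ).det ≠ 0 := by
  rw [← val_detHom_eq]
  exact Units.ne_zero _

/-- **`g ↦ det g` is continuous on `U(α, β)`.** [cite: Paul1998, §1.2 (1.2.2) p. 389 L25–29] -/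
theorem UForm.continuous_det :
    Continuous fun g : UForm α β => ((g : GL (α ⊕ β) ℂ) : Matrix (α ⊕ β) (α ⊕ β) ℂ).det :=
  (Units.continuous_val.comp continuous_subtype_val).matrix_det

variable {ω : Representation ℂ (Ginf P Q R S) (SchwartzMap (DPIdx P Q R S → ℝ) ℂ)}

/-- **The square root `s = (det^{−m})^{1/2}` (principal branch) is continuous at `1`** (`det 1 = 1` lies in the slit
plane). [cite: Paul1998, §1.2 (1.2.1)–(1.2.2) p. 389 L19–29] -/
theorem continuousAt_sqrtDatumOfDet_s (φ : UForm α β →* Ginf P Q R S) (m : ℤ)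
    (h : ∀ g, obstruction ((ι𝕎 P Q R S).comp φ) (ω.comp φ) g =
      ((g : GL (α ⊕ β) ℂ) : Matrix (α ⊕ β) (α ⊕ β) ℂ).det ^ m) :
    ContinuousAt (sqrtDatumOfDet φ m h).s 1 := by
  have hs : (sqrtDatumOfDet φ m h).s =
      fun g : UForm α β => (((g : GL (α ⊕ β) ℂ) : Matrix (α ⊕ β) (α ⊕ β) ℂ).det ^ (-m)) ^ (2⁻¹ : ℂ) := rfl
  rw [hs]
  have h1 : ContinuousAt (fun g : UForm α β => ((g : GL (α ⊕ β) ℂ) : Matrix (α ⊕ β) (α ⊕ β) ℂ).det ^ (-m)) 1 :=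
    UForm.continuous_det.continuousAt.zpow₀ (-m) (Or.inl (det_ne_zero' 1))
  have hval : (((1 : UForm α β) : GL (α ⊕ β) ℂ) : Matrix (α ⊕ β) (α ⊕ β) ℂ).det ^ (-m) = 1 := by
    simp
  exact ContinuousAt.comp_of_eq (g := fun z : ℂ => z ^ (2⁻¹ : ℂ))
    (continuousAt_cpow_const Complex.one_mem_slitPlane) h1 hval

/-- **ENGINE with continuity** — B08-2 (b)'s `exists_cocycleSection_of_obstruction_eq` with two more conclusions: the
metaplectic section `τ` (valued in `Mp^𝓢(𝕎)` with its strong operator topology) and the square root `σ` are CONTINUOUS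
AT `1`.  For a continuous `φ : U(α,β) → G_∞`, a splitting `ω` over `ι𝕎`, R1, R2 and `F ∘ φ = det^m`: for `d = 2e' − m`
there are `τ` over `ι𝕎 ∘ φ` with metaplectic values and `σ` with `σ² = det^d`, cocycle of `τ` `=` coboundary of `σ`,
both continuous at `1` — all the inputs of B08-1's `CocycleSection.continuous_lift`. [cite: Paul1998, §1.2 (1.2.1)–(1.2.2) p. 389 L11–29] -/
theorem exists_continuous_cocycleSection_of_obstruction_eq (φ : UForm α β →* Ginf P Q R S) (hφ : Continuous φ)
    (hW : IsArchWeilDatum (ι𝕎 P Q R S) ω) (hR1 : Folland1989_Thm_4_37_ab (DPIdx P Q R S))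
    (hR2 : Folland1989_Thm_4_37_c (DPIdx P Q R S)) (m e' d : ℤ) (hd : 2 * e' - m = d)
    (hm : (obstructionHom hW hR1 hR2).comp φ = (zpowGroupHom m).comp (UForm.detHom α β)) :
    ∃ (τ : UForm α β → MpS (DPIdx P Q R S)) (σ : UForm α β → ℂˣ),
      (∀ g, proj (τ g) = ι𝕎 P Q R S (φ g)) ∧ (∀ g, IsMetaplectic (τ g)) ∧
      (∀ g, σ g ^ 2 = Matrix.GeneralLinearGroup.det (g : GL (α ⊕ β) ℂ) ^ d) ∧
      (∀ g₁ g₂, τ g₁ * τ g₂ = (if σ g₁ * σ g₂ = σ (g₁ * g₂) then 1 else negOne) * τ (g₁ * g₂)) ∧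
      ContinuousAt τ 1 ∧ ContinuousAt (fun g => (σ g : ℂ)) 1 := by
  have hW' : IsArchWeilDatum ((ι𝕎 P Q R S).comp φ) (ω.comp φ) := hW.comp φ hφ
  have hmg : ∀ g, obstruction ((ι𝕎 P Q R S).comp φ) (ω.comp φ) g =
      ((g : GL (α ⊕ β) ℂ) : Matrix (α ⊕ β) (α ⊕ β) ℂ).det ^ m := fun g => by
    have h := congrArg (fun χ : UForm α β →* ℂˣ => (χ g : ℂ)) hm
    simp only [MonoidHom.comp_apply, val_obstructionHom, zpowGroupHom_apply, Units.val_zpow_eq_zpow_val,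
      val_detHom_eq] at h
    exact h
  let D := sqrtDatumOfDet φ m hmg
  have hs0 : ∀ g, D.s g * (UForm.detHom α β g : ℂ) ^ e' ≠ 0 := fun g =>
    mul_ne_zero (D.s_ne_zero g) (zpow_ne_zero _ (Units.ne_zero _))
  refine ⟨D.τ hW' hR1, fun g => Units.mk0 _ (hs0 g), fun g => D.proj_τ hW' hR1 g,
    fun g => D.isMetaplectic_τ hW' hR1 g, fun g => Units.ext ?_, fun g₁ g₂ => ?_, ?_, ?_⟩
  · rw [Units.val_pow_eq_pow_val, Units.val_mk0, Units.val_zpow_eq_zpow_val, ← detHom_eq, mul_pow,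
      ← zpow_natCast (_ ^ e'), ← zpow_mul]
    have h1 : D.s g ^ 2 = (UForm.detHom α β g : ℂ) ^ (-m) := by
      have := D.sq_mul g
      rw [hmg, ← val_detHom_eq] at this
      rw [zpow_neg]
      exact eq_inv_of_mul_eq_one_left this
    rw [h1, ← zpow_add₀ (Units.ne_zero _), ← hd]
    congr 1
    push_cast
    ring
  · rw [D.τ_mul hW' hR1 hR2]
    congr 1
    refine if_congr ⟨fun h => ?_, fun h => ?_⟩ rfl rfl
    · apply Units.ext
      rw [Units.val_mul, Units.val_mk0, Units.val_mk0, Units.val_mk0, map_mul, Units.val_mul, mul_zpow, ← h]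
      ring
    · have h' := congrArg Units.val h
      rw [Units.val_mul, Units.val_mk0, Units.val_mk0, Units.val_mk0, map_mul, Units.val_mul, mul_zpow] at h'
      have hne : (UForm.detHom α β g₁ : ℂ) ^ e' * (UForm.detHom α β g₂ : ℂ) ^ e' ≠ 0 :=
        mul_ne_zero (zpow_ne_zero _ (Units.ne_zero _)) (zpow_ne_zero _ (Units.ne_zero _))
      apply mul_right_cancel₀ hne
      linear_combination h'
  · exact D.continuousAt_τ hW' hR1 (continuousAt_sqrtDatumOfDet_s φ m hmg)
  · simp only [Units.val_mk0]
    exact (continuousAt_sqrtDatumOfDet_s φ m hmg).mul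
      (UForm.continuous_det.zpow₀ e' fun g => Or.inl (det_ne_zero' g)).continuousAt

end Member

/-! ## 3. The two members of the junction: cocycle data continuous at `1` -/

section Pair

open Literature.NumberTheory.Automorphic Literature.NumberTheory.Automorphic.UnitaryGroup
open Literature.RepresentationTheory.KonnoKonno2007 Literature.RepresentationTheory.KonnoKonno2007.RealDualPair

variable {P Q R S : Type*} [Fintype P] [DecidableEq P] [Fintype Q] [DecidableEq Q] [Fintype R] [DecidableEq R]
  [Fintype S] [DecidableEq S] {e : VacExponents}

/-- `g ↦ (g, 1)` is continuous. [folklore] -/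
private theorem continuous_inl'' : Continuous (MonoidHom.inl (UForm P Q) (UForm R S)) :=
  continuous_id.prodMk continuous_const

/-- `h ↦ (1, h)` is continuous. [folklore] -/
private theorem continuous_inr'' : Continuous (MonoidHom.inr (UForm P Q) (UForm R S)) :=
  continuous_const.prodMk continuous_id

/-- **B08-2 (b), `V`-side, `|Q| = 1`, with continuity**: `τ : U(P,Q) → Mp^𝓢(𝕎)` over `ι_V` with metaplectic values and
`σ` with `σ² = det^{|R|−|S|}`, cocycle `= ∂σ`, BOTH CONTINUOUS AT `1`. [cite: Paul1998, §1.2 (1.2.1)–(1.2.2) p. 389 L11–29] -/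
theorem exists_continuous_cocycleSectionV [Subsingleton Q] (p₀ : P) (q₀ : Q)
    (h : (junction P Q R S).FockVacuumCharacter e) (hR1 : Folland1989_Thm_4_37_ab (DPIdx P Q R S))
    (hR2 : Folland1989_Thm_4_37_c (DPIdx P Q R S)) :
    ∃ (τ : UForm P Q → MpS (DPIdx P Q R S)) (σ : UForm P Q → ℂˣ),
      (∀ g, proj (τ g) = ι𝕎 P Q R S (g, 1)) ∧ (∀ g, IsMetaplectic (τ g)) ∧
      (∀ g, σ g ^ 2 = Matrix.GeneralLinearGroup.det (g : GL (P ⊕ Q) ℂ) ^ ((Fintype.card R : ℤ) - Fintype.card S)) ∧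
      (∀ g₁ g₂, τ g₁ * τ g₂ = (if σ g₁ * σ g₂ = σ (g₁ * g₂) then 1 else negOne) * τ (g₁ * g₂)) ∧
      ContinuousAt τ 1 ∧ ContinuousAt (fun g => (σ g : ℂ)) 1 := by
  have hpin := eP_sub_eQ h p₀ q₀
  obtain ⟨ω, hW, hvac⟩ := h
  obtain ⟨τ, σ, h1, h2, h3, h4, h5, h6⟩ := exists_continuous_cocycleSection_of_obstruction_eq (MonoidHom.inl _ _)
    continuous_inl'' hW hR1 hR2 (e.eP + e.eQ) e.eP ((Fintype.card R : ℤ) - Fintype.card S) (by omega)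
    (obstructionHom_comp_inl p₀ q₀ hW hR1 hR2 hvac hpin)
  exact ⟨τ, σ, fun g => h1 g, h2, h3, h4, h5, h6⟩

/-- **B08-2 (b), `V`-side, `Q = ∅`, with continuity.** [cite: Paul1998, §1.2 (1.2.1)–(1.2.2) p. 389 L11–29; Adams2007, §3] -/
theorem exists_continuous_cocycleSectionV_of_isEmpty [IsEmpty Q] (h : (junction P Q R S).FockVacuumCharacter e)
    (hR1 : Folland1989_Thm_4_37_ab (DPIdx P Q R S)) (hR2 : Folland1989_Thm_4_37_c (DPIdx P Q R S)) :
    ∃ (τ : UForm P Q → MpS (DPIdx P Q R S)) (σ : UForm P Q → ℂˣ),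
      (∀ g, proj (τ g) = ι𝕎 P Q R S (g, 1)) ∧ (∀ g, IsMetaplectic (τ g)) ∧
      (∀ g, σ g ^ 2 = Matrix.GeneralLinearGroup.det (g : GL (P ⊕ Q) ℂ) ^ ((Fintype.card R : ℤ) - Fintype.card S)) ∧
      (∀ g₁ g₂, τ g₁ * τ g₂ = (if σ g₁ * σ g₂ = σ (g₁ * g₂) then 1 else negOne) * τ (g₁ * g₂)) ∧
      ContinuousAt τ 1 ∧ ContinuousAt (fun g => (σ g : ℂ)) 1 := by
  obtain ⟨ω, hW, hvac⟩ := h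
  obtain ⟨τ, σ, h1, h2, h3, h4, h5, h6⟩ := exists_continuous_cocycleSection_of_obstruction_eq (MonoidHom.inl _ _)
    continuous_inl'' hW hR1 hR2 (2 * e.eP + Fintype.card S - Fintype.card R) e.eP
    ((Fintype.card R : ℤ) - Fintype.card S) (by omega) (obstructionHom_comp_inl_of_isEmpty hW hR1 hR2 hvac)
  exact ⟨τ, σ, fun g => h1 g, h2, h3, h4, h5, h6⟩

/-- **B08-2 (b), `W`-side, `|S| = 1`, with continuity**: «Similarly, `Ũ(r, s)` …» — `τ : U(R,S) → Mp^𝓢(𝕎)` over `ι_W`,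
`σ² = det^{|P|−|Q|}`, cocycle `= ∂σ`, both continuous at `1`. [cite: Paul1998, §1.2 (1.2.1) p. 389 L23] -/
theorem exists_continuous_cocycleSectionW [Subsingleton S] (r₀ : R) (s₀ : S)
    (h : (junction P Q R S).FockVacuumCharacter e) (hR1 : Folland1989_Thm_4_37_ab (DPIdx P Q R S))
    (hR2 : Folland1989_Thm_4_37_c (DPIdx P Q R S)) :
    ∃ (τ : UForm R S → MpS (DPIdx P Q R S)) (σ : UForm R S → ℂˣ),
      (∀ g, proj (τ g) = ι𝕎 P Q R S (1, g)) ∧ (∀ g, IsMetaplectic (τ g)) ∧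
      (∀ g, σ g ^ 2 = Matrix.GeneralLinearGroup.det (g : GL (R ⊕ S) ℂ) ^ ((Fintype.card P : ℤ) - Fintype.card Q)) ∧
      (∀ g₁ g₂, τ g₁ * τ g₂ = (if σ g₁ * σ g₂ = σ (g₁ * g₂) then 1 else negOne) * τ (g₁ * g₂)) ∧
      ContinuousAt τ 1 ∧ ContinuousAt (fun g => (σ g : ℂ)) 1 := by
  have hpin := eR_sub_eS h r₀ s₀
  obtain ⟨ω, hW, hvac⟩ := h
  obtain ⟨τ, σ, h1, h2, h3, h4, h5, h6⟩ := exists_continuous_cocycleSection_of_obstruction_eq (MonoidHom.inr _ _)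
    continuous_inr'' hW hR1 hR2 (e.eR + e.eS) e.eR ((Fintype.card P : ℤ) - Fintype.card Q) (by omega)
    (obstructionHom_comp_inr r₀ s₀ hW hR1 hR2 hvac hpin)
  exact ⟨τ, σ, fun g => h1 g, h2, h3, h4, h5, h6⟩

/-- **B08-2 (b), `W`-side, `S = ∅`, with continuity.** [cite: Paul1998, §1.2 (1.2.1) p. 389 L23; Adams2007, §3, §6 II] -/
theorem exists_continuous_cocycleSectionW_of_isEmpty [IsEmpty S] (h : (junction P Q R S).FockVacuumCharacter e)
    (hR1 : Folland1989_Thm_4_37_ab (DPIdx P Q R S)) (hR2 : Folland1989_Thm_4_37_c (DPIdx P Q R S)) :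
    ∃ (τ : UForm R S → MpS (DPIdx P Q R S)) (σ : UForm R S → ℂˣ),
      (∀ g, proj (τ g) = ι𝕎 P Q R S (1, g)) ∧ (∀ g, IsMetaplectic (τ g)) ∧
      (∀ g, σ g ^ 2 = Matrix.GeneralLinearGroup.det (g : GL (R ⊕ S) ℂ) ^ ((Fintype.card P : ℤ) - Fintype.card Q)) ∧
      (∀ g₁ g₂, τ g₁ * τ g₂ = (if σ g₁ * σ g₂ = σ (g₁ * g₂) then 1 else negOne) * τ (g₁ * g₂)) ∧
      ContinuousAt τ 1 ∧ ContinuousAt (fun g => (σ g : ℂ)) 1 := by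
  obtain ⟨ω, hW, hvac⟩ := h
  obtain ⟨τ, σ, h1, h2, h3, h4, h5, h6⟩ := exists_continuous_cocycleSection_of_obstruction_eq (MonoidHom.inr _ _)
    continuous_inr'' hW hR1 hR2 (2 * e.eR + Fintype.card Q - Fintype.card P) e.eR
    ((Fintype.card P : ℤ) - Fintype.card Q) (by omega) (obstructionHom_comp_inr_of_isEmpty hW hR1 hR2 hvac)
  exact ⟨τ, σ, fun g => h1 g, h2, h3, h4, h5, h6⟩

/-! ## 4. The junction: B08-1 cocycle sections over `Mp₂.coverDatum` -/

/-- The cocycle identity, co-restricted into `Mp₂(W)` (`negOne ↦ ε`); stated over an arbitrary index type `σ` and an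
arbitrary multiplicative domain (elaboration is cheap there and the instance at `DPIdx P Q R S` is a substitution).
[cite: Paul1998, §1.2 (1.2.1) p. 389 L11–23] -/
private theorem mk_mul_mk_eq {G : Type*} [Mul G] (τ : G → MpS σ) (s : G → ℂˣ) (hmet : ∀ g, IsMetaplectic (τ g))
    (hmul : ∀ g₁ g₂, τ g₁ * τ g₂ = (if s g₁ * s g₂ = s (g₁ * g₂) then 1 else negOne) * τ (g₁ * g₂)) (g₁ g₂ : G) :
    (⟨τ g₁, Mp₂.mem_of_isMetaplectic (hmet g₁)⟩ : Mp₂ σ) * ⟨τ g₂, Mp₂.mem_of_isMetaplectic (hmet g₂)⟩ =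
      (if s g₁ * s g₂ = s (g₁ * g₂) then 1 else Mp₂.ε) * ⟨τ (g₁ * g₂), Mp₂.mem_of_isMetaplectic (hmet (g₁ * g₂))⟩ := by
  by_cases hc : s g₁ * s g₂ = s (g₁ * g₂)
  · rw [if_pos hc]
    apply Subtype.ext
    have h := hmul g₁ g₂
    rw [if_pos hc] at h
    exact h
  · rw [if_neg hc]
    apply Subtype.ext
    have h := hmul g₁ g₂
    rw [if_neg hc] at h
    exact h

variable [Nonempty (P ⊕ Q)] [Nonempty (R ⊕ S)]

/-- **JUNCTION, `V`-side**: `Mp^𝓢(𝕎)`-valued metaplectic cocycle data over `ι_V` (the output shape of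
`DetCoverCocycleRankOne`), co-restricted into `Mp₂(𝕎)`, IS a B08-1 cocycle section of the Paul datum
`Mp₂.coverDatum P Q R S h1 h2` for the exponent `|R| − |S|` (fields `τ, σ, pr_τ, σ_sq, τ_mul`; `ε = −1`).
[cite: Paul1998, §1.2 (1.2.1) p. 389 L11–23] -/
def cocycleSectionV (h1 : Folland1989_Thm_4_37_ab (DPIdx P Q R S)) (h2 : Folland1989_Thm_4_37_c (DPIdx P Q R S))
    (τ : UForm P Q → MpS (DPIdx P Q R S)) (σ : UForm P Q → ℂˣ) (hpr : ∀ g, proj (τ g) = ι𝕎 P Q R S (g, 1))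
    (hmet : ∀ g, IsMetaplectic (τ g))
    (hσ : ∀ g, σ g ^ 2 = Matrix.GeneralLinearGroup.det (g : GL (P ⊕ Q) ℂ) ^ ((Fintype.card R : ℤ) - Fintype.card S))
    (hmul : ∀ g₁ g₂, τ g₁ * τ g₂ = (if σ g₁ * σ g₂ = σ (g₁ * g₂) then 1 else negOne) * τ (g₁ * g₂)) :
    (Mp₂.coverDatum P Q R S h1 h2).CocycleSection ((Fintype.card R : ℤ) - Fintype.card S) where
  τ g := ⟨τ g, Mp₂.mem_of_isMetaplectic (hmet g)⟩
  σ := σ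
  pr_τ g := hpr g
  σ_sq := hσ
  τ_mul g₁ g₂ := mk_mul_mk_eq τ σ hmet hmul g₁ g₂

/-- **JUNCTION, `W`-side**: the same over `ι_W`, a cocycle section of the SWAPPED datum for the exponent `|P| − |Q|`
(«Similarly, `Ũ(r, s)` …»). [cite: Paul1998, §1.2 (1.2.1) p. 389 L23] -/
def cocycleSectionW (h1 : Folland1989_Thm_4_37_ab (DPIdx P Q R S)) (h2 : Folland1989_Thm_4_37_c (DPIdx P Q R S))
    (τ : UForm R S → MpS (DPIdx P Q R S)) (σ : UForm R S → ℂˣ) (hpr : ∀ g, proj (τ g) = ι𝕎 P Q R S (1, g))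
    (hmet : ∀ g, IsMetaplectic (τ g))
    (hσ : ∀ g, σ g ^ 2 = Matrix.GeneralLinearGroup.det (g : GL (R ⊕ S) ℂ) ^ ((Fintype.card P : ℤ) - Fintype.card Q))
    (hmul : ∀ g₁ g₂, τ g₁ * τ g₂ = (if σ g₁ * σ g₂ = σ (g₁ * g₂) then 1 else negOne) * τ (g₁ * g₂)) :
    (Mp₂.coverDatum P Q R S h1 h2).swap.CocycleSection ((Fintype.card P : ℤ) - Fintype.card Q) where
  τ g := ⟨τ g, Mp₂.mem_of_isMetaplectic (hmet g)⟩
  σ := σ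
  pr_τ g := hpr g
  σ_sq := hσ
  τ_mul g₁ g₂ := mk_mul_mk_eq τ σ hmet hmul g₁ g₂

/-- **B08-1's commutation hypothesis `hc` for `Mp₂.coverDatum`**: `Ũ(P,Q)` and `Ũ(R,S)` commute inside `Mp₂(𝕎)` — from
the splitting ([Adams2007, Rem. 5.1] «`G̃` commutes with `G̃′`»; b19's `Mp₂.coverV_coverW_commutator` gave it up to
`ε`, the splitting removes the sign). [cite: Adams2007, Rem. 5.1; Paul1998, §1.1 p. 389 L5–6] -/
theorem commute_coverV_coverW (hFV : (junction P Q R S).FockVacuumCharacter e)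
    (h1 : Folland1989_Thm_4_37_ab (DPIdx P Q R S)) (h2 : Folland1989_Thm_4_37_c (DPIdx P Q R S)) :
    ∀ m ∈ (Mp₂.coverDatum P Q R S h1 h2).coverV, ∀ m' ∈ (Mp₂.coverDatum P Q R S h1 h2).coverW, Commute m m' := by
  intro m hm m' hm'
  obtain ⟨g, hg⟩ := (Mp₂.mem_coverV_iff h1 h2 m).1 hm
  obtain ⟨h, hh⟩ := (Mp₂.mem_coverW_iff h1 h2 m').1 hm'
  have hc : Commute (m : MpS (DPIdx P Q R S)) (m' : MpS (DPIdx P Q R S)) :=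
    commute_of_fockVacuumCharacter hFV hg.symm hh.symm
  exact Subtype.ext hc.eq

/-! ## 5. The record `DetCoverLifting` of `Mp₂.coverDatum`, PROVED at real rank `≤ 1` -/

omit [Nonempty (P ⊕ Q)] [Nonempty (R ⊕ S)] in
/-- continuity at `1` of a `Mp₂(𝕎)`-valued co-restriction from that of the `Mp^𝓢(𝕎)`-valued map. [folklore] -/
private theorem continuousAt_codRestrict {X : Type*} [TopologicalSpace X] {F : X → MpS (DPIdx P Q R S)}
    (hF : ∀ t, F t ∈ Mp₂ (DPIdx P Q R S)) {t₀ : X} (h : ContinuousAt F t₀) :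
    ContinuousAt (fun t => (⟨F t, hF t⟩ : Mp₂ (DPIdx P Q R S))) t₀ :=
  Mp₂.continuousAt_iff.2 (MpS.continuousAt_iff.1 h)

/-- **[Paul1998, (1.2.1)–(1.2.2)] for `S̃p = Mp₂(𝕎)`, both members of real rank one (`|Q| = |S| = 1`)**: from the
record `FockVacuumCharacter e` (a splitting of the `S¹`-extension over `ι𝕎`) and R1, R2 — there is a CONTINUOUS
homomorphism `ι̃` from the product of the `det^{(|R|−|S|)/2}`-cover of `U(P,Q)` and the `det^{(|P|−|Q|)/2}`-cover of
`U(R,S)` into `Mp₂(𝕎)` (strong operator topology) over `ι_J = ι𝕎`, an isomorphism of each factor onto `Ũ(P,Q)`, resp.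
`Ũ(R,S)`, carrying `(1,−1)` to `ε`: the record `DetCoverLifting` of `Mp₂.coverDatum P Q R S h1 h2` HOLDS.
[cite: Paul1998, §1.2 (1.2.1)–(1.2.2) p. 389 L11–31] -/
theorem detCoverLifting_of_fockVacuumCharacter [Subsingleton Q] [Subsingleton S] (p₀ : P) (q₀ : Q) (r₀ : R)
    (s₀ : S) (hFV : (junction P Q R S).FockVacuumCharacter e) (h1 : Folland1989_Thm_4_37_ab (DPIdx P Q R S))
    (h2 : Folland1989_Thm_4_37_c (DPIdx P Q R S)) : (Mp₂.coverDatum P Q R S h1 h2).DetCoverLifting := by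
  obtain ⟨τV, σV, hV1, hV2, hV3, hV4, hV5, hV6⟩ := exists_continuous_cocycleSectionV p₀ q₀ hFV h1 h2
  obtain ⟨τW, σW, hW1, hW2, hW3, hW4, hW5, hW6⟩ := exists_continuous_cocycleSectionW r₀ s₀ hFV h1 h2
  exact DualPairCoverDatum.detCoverLifting_of_cocycleSections (cocycleSectionV h1 h2 τV σV hV1 hV2 hV3 hV4)
    (cocycleSectionW h1 h2 τW σW hW1 hW2 hW3 hW4) (commute_coverV_coverW hFV h1 h2)
    (continuousAt_codRestrict _ hV5) hV6 (continuousAt_codRestrict _ hW5) hW6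

/-- **The record for `|Q| = 1`, `S = ∅`** (first member of real rank one, second member compact).
[cite: Paul1998, §1.2 (1.2.1)–(1.2.2) p. 389 L11–31; Adams2007, §3, §6 II] -/
theorem detCoverLifting_of_fockVacuumCharacter_of_isEmpty_right [Subsingleton Q] [IsEmpty S] (p₀ : P) (q₀ : Q)
    (hFV : (junction P Q R S).FockVacuumCharacter e) (h1 : Folland1989_Thm_4_37_ab (DPIdx P Q R S))
    (h2 : Folland1989_Thm_4_37_c (DPIdx P Q R S)) : (Mp₂.coverDatum P Q R S h1 h2).DetCoverLifting := by
  obtain ⟨τV, σV, hV1, hV2, hV3, hV4, hV5, hV6⟩ := exists_continuous_cocycleSectionV p₀ q₀ hFV h1 h2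
  obtain ⟨τW, σW, hW1, hW2, hW3, hW4, hW5, hW6⟩ := exists_continuous_cocycleSectionW_of_isEmpty hFV h1 h2
  exact DualPairCoverDatum.detCoverLifting_of_cocycleSections (cocycleSectionV h1 h2 τV σV hV1 hV2 hV3 hV4)
    (cocycleSectionW h1 h2 τW σW hW1 hW2 hW3 hW4) (commute_coverV_coverW hFV h1 h2)
    (continuousAt_codRestrict _ hV5) hV6 (continuousAt_codRestrict _ hW5) hW6

/-- **The record for `Q = ∅`, `|S| = 1`.** [cite: Paul1998, §1.2 (1.2.1)–(1.2.2) p. 389 L11–31; Adams2007, §3, §6 II] -/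
theorem detCoverLifting_of_fockVacuumCharacter_of_isEmpty_left [IsEmpty Q] [Subsingleton S] (r₀ : R) (s₀ : S)
    (hFV : (junction P Q R S).FockVacuumCharacter e) (h1 : Folland1989_Thm_4_37_ab (DPIdx P Q R S))
    (h2 : Folland1989_Thm_4_37_c (DPIdx P Q R S)) : (Mp₂.coverDatum P Q R S h1 h2).DetCoverLifting := by
  obtain ⟨τV, σV, hV1, hV2, hV3, hV4, hV5, hV6⟩ := exists_continuous_cocycleSectionV_of_isEmpty hFV h1 h2
  obtain ⟨τW, σW, hW1, hW2, hW3, hW4, hW5, hW6⟩ := exists_continuous_cocycleSectionW r₀ s₀ hFV h1 h2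
  exact DualPairCoverDatum.detCoverLifting_of_cocycleSections (cocycleSectionV h1 h2 τV σV hV1 hV2 hV3 hV4)
    (cocycleSectionW h1 h2 τW σW hW1 hW2 hW3 hW4) (commute_coverV_coverW hFV h1 h2)
    (continuousAt_codRestrict _ hV5) hV6 (continuousAt_codRestrict _ hW5) hW6

/-- **The record for `Q = ∅`, `S = ∅`** (both members compact: the `det^{1/2}`-type covers of `U(P) × U(R)`).
[cite: Paul1998, §1.2 (1.2.1)–(1.2.2) p. 389 L11–31; Adams2007, §3] -/
theorem detCoverLifting_of_fockVacuumCharacter_of_isEmpty [IsEmpty Q] [IsEmpty S]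
    (hFV : (junction P Q R S).FockVacuumCharacter e) (h1 : Folland1989_Thm_4_37_ab (DPIdx P Q R S))
    (h2 : Folland1989_Thm_4_37_c (DPIdx P Q R S)) : (Mp₂.coverDatum P Q R S h1 h2).DetCoverLifting := by
  obtain ⟨τV, σV, hV1, hV2, hV3, hV4, hV5, hV6⟩ := exists_continuous_cocycleSectionV_of_isEmpty hFV h1 h2
  obtain ⟨τW, σW, hW1, hW2, hW3, hW4, hW5, hW6⟩ := exists_continuous_cocycleSectionW_of_isEmpty hFV h1 h2
  exact DualPairCoverDatum.detCoverLifting_of_cocycleSections (cocycleSectionV h1 h2 τV σV hV1 hV2 hV3 hV4)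
    (cocycleSectionW h1 h2 τW σW hW1 hW2 hW3 hW4) (commute_coverV_coverW hFV h1 h2)
    (continuousAt_codRestrict _ hV5) hV6 (continuousAt_codRestrict _ hW5) hW6

/-- **The record at the linearised slots, from R1 and R2 ALONE**: for the pairs `U(P,1) × U(R,∅)`, `R ≠ ∅` — the
E-term's `U(2,1) × U(1)` and `U(2,1) × U(2)` — `(Mp₂.coverDatum P Q R S h1 h2).DetCoverLifting` holds (the splitting is
the tree's linearised Weil datum, `fockVacuumCharacter_linearised`). [cite: Paul1998, §1.2 (1.2.1)–(1.2.2) p. 389 L11–31] -/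
theorem detCoverLifting_linearised [Nonempty R] [IsEmpty S] [Subsingleton Q] (p₀ : P) (q₀ : Q)
    (h1 : Folland1989_Thm_4_37_ab (DPIdx P Q R S)) (h2 : Folland1989_Thm_4_37_c (DPIdx P Q R S)) :
    (Mp₂.coverDatum P Q R S h1 h2).DetCoverLifting :=
  detCoverLifting_of_fockVacuumCharacter_of_isEmpty_right p₀ q₀ (fockVacuumCharacter_linearised R S p₀ q₀) h1 h2

/-- **Topology-free corollary**: a det-cover lifting `ι̃ : Ũ(P,Q)_{det} × Ũ(R,S)_{det} →* Mp₂(𝕎)` in the sense of the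
record (`IsDetCoverLifting`) EXISTS at the linearised slots, under R1/R2. [cite: Paul1998, §1.2 (1.2.1) p. 389 L11–23] -/
theorem exists_isDetCoverLifting_linearised [Nonempty R] [IsEmpty S] [Subsingleton Q] (p₀ : P) (q₀ : Q)
    (h1 : Folland1989_Thm_4_37_ab (DPIdx P Q R S)) (h2 : Folland1989_Thm_4_37_c (DPIdx P Q R S)) :
    ∃ L : detCover (Mp₂.coverDatum P Q R S h1 h2).GV ((Fintype.card R : ℤ) - Fintype.card S) ×
        detCover (Mp₂.coverDatum P Q R S h1 h2).GW ((Fintype.card P : ℤ) - Fintype.card Q) →* Mp₂ (DPIdx P Q R S),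
      (Mp₂.coverDatum P Q R S h1 h2).IsDetCoverLifting L :=
  (detCoverLifting_linearised p₀ q₀ h1 h2).exists_isDetCoverLifting

/-! ## 6. Hypothesis-free: R1 and R2 are theorems of the tree (row B07-3, `ArchMetaplecticDoubleCoverHolds`) -/

/-- **UNCONDITIONAL at the linearised slots**: for the pairs `U(P,1) × U(R,∅)`, `R ≠ ∅` (the E-term's `U(2,1) × U(1)`,
`U(2,1) × U(2)`), the Paul record `DetCoverLifting` of the metaplectic det-cover datum
`Mp₂.coverDatum P Q R S R1 R2` HOLDS WITH NO HYPOTHESIS — R1/R2 being the tree's theorems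
`folland1989_Thm_4_37_ab_holds`, `folland1989_Thm_4_37_c_holds` [Folland1989, Thm. (4.37)] and the splitting the tree's
linearised Weil datum. [cite: Paul1998, §1.2 (1.2.1)–(1.2.2) p. 389 L11–31; Folland1989, §4.2 Thm. (4.37)] -/
theorem detCoverLifting_linearised_holds [Nonempty R] [IsEmpty S] [Subsingleton Q] (p₀ : P) (q₀ : Q) :
    (Mp₂.coverDatum P Q R S (folland1989_Thm_4_37_ab_holds (DPIdx P Q R S))
      (folland1989_Thm_4_37_c_holds (DPIdx P Q R S))).DetCoverLifting :=
  detCoverLifting_linearised p₀ q₀ _ _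

/-- **The record from the splitting alone** (both members of real rank one): `FockVacuumCharacter e` ⟹
`DetCoverLifting` for `Mp₂.coverDatum P Q R S R1 R2`, R1/R2 discharged by the tree. [cite: Paul1998, §1.2 (1.2.1)–(1.2.2) p. 389 L11–31; Folland1989, §4.2 Thm. (4.37)] -/
theorem detCoverLifting_of_fockVacuumCharacter_holds [Subsingleton Q] [Subsingleton S] (p₀ : P) (q₀ : Q) (r₀ : R)
    (s₀ : S) (hFV : (junction P Q R S).FockVacuumCharacter e) :
    (Mp₂.coverDatum P Q R S (folland1989_Thm_4_37_ab_holds (DPIdx P Q R S))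
      (folland1989_Thm_4_37_c_holds (DPIdx P Q R S))).DetCoverLifting :=
  detCoverLifting_of_fockVacuumCharacter p₀ q₀ r₀ s₀ hFV _ _

/-- **Topology-free, hypothesis-free**: a det-cover lifting `ι̃` into `Mp₂(𝕎)` in the sense of the record EXISTS at the
linearised slots. [cite: Paul1998, §1.2 (1.2.1) p. 389 L11–23; Folland1989, §4.2 Thm. (4.37)] -/
theorem exists_isDetCoverLifting_linearised_holds [Nonempty R] [IsEmpty S] [Subsingleton Q] (p₀ : P) (q₀ : Q) :
    ∃ L : detCover (Mp₂.coverDatum P Q R S (folland1989_Thm_4_37_ab_holds (DPIdx P Q R S))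
          (folland1989_Thm_4_37_c_holds (DPIdx P Q R S))).GV ((Fintype.card R : ℤ) - Fintype.card S) ×
        detCover (Mp₂.coverDatum P Q R S (folland1989_Thm_4_37_ab_holds (DPIdx P Q R S))
          (folland1989_Thm_4_37_c_holds (DPIdx P Q R S))).GW ((Fintype.card P : ℤ) - Fintype.card Q) →*
          Mp₂ (DPIdx P Q R S),
      (Mp₂.coverDatum P Q R S (folland1989_Thm_4_37_ab_holds (DPIdx P Q R S))
        (folland1989_Thm_4_37_c_holds (DPIdx P Q R S))).IsDetCoverLifting L :=
  (detCoverLifting_linearised_holds p₀ q₀).exists_isDetCoverLifting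

end Pair

end MetaplecticSplitting

end Literature.RepresentationTheory.Paul1998

end
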